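import Literature.Claims.NS.ClayR3HorizonBridge
import Literature.Analysis.FluidPDE.NSTaoClassOfSobolevDatum
import HarnessLib

/-!
# Clay (C) reference — whole-space SUP-NORM blow-up certificates: velocity, gradient, vorticity or
# any spatial derivative unbounded on `[0, T) × ℝ³` for a finite-energy classical solution proves (C)

Companion to `Literature/Claims/NS/ClayR3HorizonBridge.lean` (ns-claims-lit-4 g4), whose blow-up
certificates for the whole-space problem had to be LOCALISED to a compact `K ⊆ ℝ³`
(`navierStokesBreakdownR3_of_localBlowupCertificate` / `…localGradient…` / `…localVorticity…`: a
Clay solution is continuous, hence bounded, on the compact `[0, T] × K` — nothing more was used),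
and the `ℝ³` twin of the periodic file `ClayPeriodicSupBlowupCertificate.lean`. On `ℝ³` a smooth
function need not be bounded, so the plain sup-norm statements most whole-space blow-up texts print —
«`‖u(t)‖_{L^∞(ℝ³)} → ∞`», «`‖∇u(t)‖_∞ → ∞`», «`‖ω(t)‖_∞ → ∞` as `t ↑ T*`» (Leray 1934 §33;
Beale–Kato–Majda 1984) — need one more input to contradict Clay (A): a Clay-class solution IS bounded,
with all its spatial derivatives, on every closed slab `[0, T] × ℝ³`. That input is a theorem of the
tree: Tao 2013, Cor. 11.1 + Cor. 4.3 + Thm. 5.4 (iv) (a finite-energy classical solution on a CLOSED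
slab with an `H^∞` datum lies in `L^∞_t H^k_x` for every `k`,
`IsClassicalNSSolutionOn.hasBoundedSobolevNormsOn_of_sobolevDatum_unforced`) with the Sobolev embedding
`H²(ℝ³) ⊂ C_B` (`IsClassicalNSSolutionOn.exists_norm_iteratedFDeriv_le_of_sobolevDatum`), Clay data (4)
being `H^∞` (`HasRapidSpatialDecay.lintegral_enorm_iteratedFDeriv_sq_lt_top`). Hence:

* `exists_norm_iteratedFDeriv_le_of_claySolution` — a Clay (A)-class solution (`C^∞` on
  `ℝ³ × [0,∞)`, bounded energy (7), datum of class (4), `μ > 0`) has every spatial derivative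
  `Dⁿu` bounded on every `[0, T] × ℝ³`;
* `exists_bounds_of_clayR3_solvable` — if the unforced Cauchy problem `(μ, u₀)` is Clay-solvable,
  then EVERY classical solution on `[0, T) × ℝ³` with `u(0) = u₀` and finite energy on `[0, T)` has
  `Dⁿu` bounded on `[0, T) × ℝ³` for every `n` (it coincides there with the Clay solution by Tao's
  uniqueness of smooth finite-energy solutions, Cor. 11.4 — `eqOn_Ico_of_claySolution`);
* `not_clayR3_solvable_of_derivSupCertificate` / `…_of_velocitySupCertificate` /
  `…_of_gradientSupCertificate` / `…_of_vorticitySupCertificate` — so a finite-energy classical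
  solution on `[0, T)` whose `n`-th derivative / velocity / gradient / vorticity `curl u` is UNBOUNDED
  on `[0, T) × ℝ³` (`∀ M, ∃ t ∈ [0,T), ∃ x, M < |·|`) excludes Clay solvability of its datum at `μ`;
* `navierStokesBreakdownR3_of_derivSupCertificate` / `…velocity…` / `…gradient…` / `…vorticity…` —
  with a smooth divergence-free datum of class (4) and ONE viscosity `μ > 0`, each certificate proves
  the leaf `NavierStokesBreakdownR3` (Clay (C), every `ν > 0`, via
  `navierStokesBreakdownR3_of_not_solvable` = the Δ7 viscosity scaling of `ClayVariants.lean`).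

The finite-energy hypothesis on the certificate's solution (`sup_{[0,T)} ∫|u(t)|² < ∞`) is what makes
it comparable with the Clay solution (Tao's uniqueness class); without it no uniqueness theorem is in
print (Tao 2013, Remark 1.2), and the parasitic example of `ClaySettingParasiticDrift.lean` shows
that smoothness alone does not determine the solution.

Usage on a CARD (§3, axis Δ6/Δ7, whole-space NEG rows): a claimed blow-up «`‖u(t)‖_∞ → ∞` (or
`‖∇u‖_∞`, `‖ω‖_∞ → ∞`) as `t ↑ T*`» for a classical finite-energy solution on `[0, T*) × ℝ³` from a
datum of class (4) composes with `navierStokesBreakdownR3_of_velocitySupCertificate` (resp.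
`…gradient…`, `…vorticity…`) — no Δ6/Δ7 delta and no localisation to a compact set needed; what stays
a delta: a datum outside (4) (Δ4), forcing (Δ3), a solution class without finite energy (Δ5: then the
certificate says nothing about the Clay solution), `ν = 0` (Δ2/Δ7).

## Mathlib / tree search

Reused (all theorems of the tree): `clayR3_solvable_zero_iff_classical`, `eqOn_Ico_of_claySolution`,
`memLp_fderiv_two_of_rapidDecay`, `navierStokesBreakdownR3_of_not_solvable` (`ClayVariants` /
`ClayR3HorizonBridge`); `IsClassicalNSSolutionOn.exists_norm_iteratedFDeriv_le_of_sobolevDatum`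
(`NSTaoClassOfSobolevDatum`); `HasRapidSpatialDecay.lintegral_enorm_iteratedFDeriv_sq_lt_top`
(`TaoLocalisation`); `norm_curl_le` (`TaoEnstrophyLocalisation`); Mathlib `norm_iteratedFDeriv_zero`,
`norm_iteratedFDeriv_one`.

## References

* C. L. Fefferman, *Existence and smoothness of the Navier–Stokes equation*, CMI 2006, (A), (C) with
  (4)–(7) p. 2. [FeffermanClay2006]
* T. Tao, *Localisation and compactness properties of the Navier–Stokes global regularity problem*,
  Anal. PDE 6 (2013) 25–107: Cor. 11.1, Cor. 11.4, Remark 1.2, Thm. 5.4 (iv). [Tao2013Localisation]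
  (tree bib key of the proofs files: `Tao2011` = arXiv:1108.1165.)
* J. T. Beale, T. Kato, A. Majda, Comm. Math. Phys. 94 (1984), §1. [BealeKatoMajda1984]
* R. A. Adams, J. J. F. Fournier, *Sobolev Spaces*, 2nd ed., Thm. 4.12. [AdamsFournier2003]

WHAT THIS IS NOT: not a claim about NS regularity or blow-up; not a claim about any author beyond
the typed locator.
-/

open scoped ContDiff ENNReal NNReal Topology

namespace Literature.Claims.NS.ClayVariants

open Set Filter MeasureTheory Function Literature.Analysis Literature.Analysis.FluidPDE

noncomputable section

variable {μ T : ℝ} {u₀ : EuclideanSpace ℝ (Fin 3) → EuclideanSpace ℝ (Fin 3)}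
  {u : ℝ → EuclideanSpace ℝ (Fin 3) → EuclideanSpace ℝ (Fin 3)} {p : ℝ → EuclideanSpace ℝ (Fin 3) → ℝ}

/-- **Every spatial derivative of a Clay (A)-class solution is bounded on every closed slab.** Let
`μ > 0` and let `(w, q)` be a classical solution of the unforced system on `ℝ³ × [0, ∞)` with bounded
energy (7) whose datum `w 0 = u₀` is rapidly decaying (4). Then for every `T > 0` and `n`, one finite
constant bounds `‖Dⁿw(t, x)‖` on `[0, T] × ℝ³`: restrict to the closed slab, where Tao's Cor. 11.1 +
Thm. 5.4 (iv) put `w` in `L^∞_t H^k_x` for all `k` (the datum is `H^∞` by (4)), and apply the Sobolev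
embedding `H² ⊂ C_B` to `Dⁿw(t)` (tree theorem
`IsClassicalNSSolutionOn.exists_norm_iteratedFDeriv_le_of_sobolevDatum`).
[cite: Tao2011, Cor. 11.1 + Thm. 5.4 (iv) (arXiv Cor. 68, Thm. 31 (iv))] [cite: AdamsFournier2003, Thm. 4.12 Part I Case A] -/
theorem exists_norm_iteratedFDeriv_le_of_claySolution (hμ : 0 < μ) (hdec : HasRapidSpatialDecay u₀)
    {w : ℝ → EuclideanSpace ℝ (Fin 3) → EuclideanSpace ℝ (Fin 3)}
    {q : ℝ → EuclideanSpace ℝ (Fin 3) → ℝ}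
    (hw : IsClassicalNSSolutionOn (Ici 0) μ 0 w q) (hw0 : w 0 = u₀) (hwE : HasBoundedEnergy w)
    (hT : 0 < T) (n : ℕ) :
    ∃ B : ℝ, 0 ≤ B ∧ ∀ t ∈ Icc 0 T, ∀ x, ‖iteratedFDeriv ℝ n (w t) x‖ ≤ B := by
  have hw' : IsClassicalNSSolutionOn (Icc 0 T) μ 0 w q :=
    hw.mono Icc_subset_Ici_self (uniqueDiffOn_Icc hT)
  have hE : ∃ C : ℝ≥0, ∀ t ∈ Icc 0 T, ∫⁻ x, ‖w t x‖ₑ ^ 2 ≤ C := by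
    obtain ⟨C, hC, hb⟩ := hwE
    exact ⟨C.toNNReal, fun t ht => (hb t ht.1).trans (ENNReal.coe_toNNReal hC.ne).ge⟩
  have h₀ : ∀ m : ℕ, ∫⁻ x, ‖iteratedFDeriv ℝ m (w 0) x‖ₑ ^ 2 < ⊤ := fun m => by
    rw [hw0]
    exact hdec.lintegral_enorm_iteratedFDeriv_sq_lt_top (μ := volume) m
  have hf : ∀ m : ℕ, ∃ C : ℝ≥0, ∀ t ∈ Icc 0 T,
      ∫⁻ x, ‖iteratedFDeriv ℝ m
        ((0 : ℝ → EuclideanSpace ℝ (Fin 3) → EuclideanSpace ℝ (Fin 3)) t) x‖ₑ ^ 2 ≤ C :=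
    fun m => ⟨0, fun t _ => by simp⟩
  exact hw'.exists_norm_iteratedFDeriv_le_of_sobolevDatum hμ hT hE h₀ hf n

/-- **Clay (A)-solvability bounds every finite-energy classical solution from the same datum, with
all its derivatives, on its horizon.** Let `μ > 0`, `u₀` a `C¹` datum of class (4), and `(u, p)` a
classical solution of the unforced system on `[0, T) × ℝ³` with `u 0 = u₀` and finite energy on
`[0, T)`. If `(μ, 0, u₀)` is Clay-solvable, then for every `n` the derivative `Dⁿu` is bounded on
`[0, T) × ℝ³`: the Clay solution equals `u` on `[0, T)` (Tao's Cor. 11.4, `eqOn_Ico_of_claySolution`)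
and is bounded with its derivatives on `[0, T] × ℝ³` (`exists_norm_iteratedFDeriv_le_of_claySolution`).
[cite: FeffermanClay2006, (A) with (4) (6) (7) p. 2] [cite: Tao2011, Cor. 11.4 + Cor. 11.1 (arXiv Cor. 71, Cor. 68)] -/
theorem exists_bounds_of_clayR3_solvable (hμ : 0 < μ) (hu₀ : ContDiff ℝ 1 u₀)
    (hdec : HasRapidSpatialDecay u₀)
    (hcl : IsClassicalNSSolutionOn (Ico 0 T) μ 0 u p) (hu0 : u 0 = u₀)
    (hE : ∃ A : ℝ≥0∞, A < ⊤ ∧ ∀ t ∈ Ico 0 T, ∫⁻ x, ‖u t x‖ₑ ^ 2 ≤ A)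
    (hsol : clayR3.Solvable μ 0 u₀) (n : ℕ) :
    ∃ B : ℝ, ∀ t ∈ Ico 0 T, ∀ x, ‖iteratedFDeriv ℝ n (u t) x‖ ≤ B := by
  rcases le_or_gt T 0 with hT | hT
  · exact ⟨0, fun t ht => absurd (ht.1.trans_lt (ht.2.trans_le hT)) (lt_irrefl 0)⟩
  obtain ⟨w, q, hw, hw0, hwE⟩ := clayR3_solvable_zero_iff_classical.mp hsol
  have heq : ∀ t ∈ Ico 0 T, w t = u t :=
    eqOn_Ico_of_claySolution hμ (memLp_fderiv_two_of_rapidDecay hdec hu₀) hw hw0 hwE hcl hu0 hE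
  obtain ⟨B, -, hB⟩ := exists_norm_iteratedFDeriv_le_of_claySolution hμ hdec hw hw0 hwE hT n
  exact ⟨B, fun t ht x => by rw [← heq t ht]; exact hB t (Ico_subset_Icc_self ht) x⟩

/-- **A DERIVATIVE sup-norm blow-up certificate excludes Clay solvability**: a finite-energy
classical solution on `[0, T) × ℝ³` from a `C¹` datum of class (4) whose `n`-th spatial derivative is
UNBOUNDED on `[0, T) × ℝ³` (`∀ M, ∃ t ∈ [0,T), ∃ x, M < ‖Dⁿu(t,x)‖`) ⇒ `(μ, 0, u₀)` has no Clay
(A)-class solution. [cite: FeffermanClay2006, (A) (C) with (4)–(7) p. 2] [cite: Tao2011, Cor. 11.4 + Cor. 11.1] -/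
theorem not_clayR3_solvable_of_derivSupCertificate (hμ : 0 < μ) (hu₀ : ContDiff ℝ 1 u₀)
    (hdec : HasRapidSpatialDecay u₀)
    (hcl : IsClassicalNSSolutionOn (Ico 0 T) μ 0 u p) (hu0 : u 0 = u₀)
    (hE : ∃ A : ℝ≥0∞, A < ⊤ ∧ ∀ t ∈ Ico 0 T, ∫⁻ x, ‖u t x‖ₑ ^ 2 ≤ A) {n : ℕ}
    (hblow : ∀ M : ℝ, ∃ t ∈ Ico 0 T, ∃ x : EuclideanSpace ℝ (Fin 3),
      M < ‖iteratedFDeriv ℝ n (u t) x‖) :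
    ¬ clayR3.Solvable μ 0 u₀ := fun hsol => by
  obtain ⟨B, hB⟩ := exists_bounds_of_clayR3_solvable hμ hu₀ hdec hcl hu0 hE hsol n
  obtain ⟨t, ht, x, hM⟩ := hblow B
  exact absurd hM (not_lt.2 (hB t ht x))

/-- **A VELOCITY sup-norm blow-up certificate excludes Clay solvability** («`‖u(t)‖_{L^∞(ℝ³)}` is
unbounded on `[0, T)`», Leray's form): `∀ M, ∃ t ∈ [0,T), ∃ x, M < |u(t,x)|` for a finite-energy
classical solution on `[0, T) × ℝ³` from a `C¹` datum of class (4) ⇒ no Clay solution at `μ`.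
[cite: FeffermanClay2006, (A) (C) with (4)–(7) p. 2] [cite: Tao2011, Cor. 11.4 + Cor. 11.1] -/
theorem not_clayR3_solvable_of_velocitySupCertificate (hμ : 0 < μ) (hu₀ : ContDiff ℝ 1 u₀)
    (hdec : HasRapidSpatialDecay u₀)
    (hcl : IsClassicalNSSolutionOn (Ico 0 T) μ 0 u p) (hu0 : u 0 = u₀)
    (hE : ∃ A : ℝ≥0∞, A < ⊤ ∧ ∀ t ∈ Ico 0 T, ∫⁻ x, ‖u t x‖ₑ ^ 2 ≤ A)
    (hblow : ∀ M : ℝ, ∃ t ∈ Ico 0 T, ∃ x : EuclideanSpace ℝ (Fin 3), M < ‖u t x‖) :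
    ¬ clayR3.Solvable μ 0 u₀ :=
  not_clayR3_solvable_of_derivSupCertificate hμ hu₀ hdec hcl hu0 hE (n := 0) fun M => by
    obtain ⟨t, ht, x, hM⟩ := hblow M
    exact ⟨t, ht, x, by rwa [norm_iteratedFDeriv_zero]⟩

/-- **A GRADIENT sup-norm blow-up certificate excludes Clay solvability** (pointwise form of
Beale–Kato–Majda's criterion on `ℝ³`: `‖∇u‖` unbounded on `[0, T) × ℝ³`).
[cite: FeffermanClay2006, (A) (C) with (4)–(7) p. 2] [cite: BealeKatoMajda1984, §1] -/
theorem not_clayR3_solvable_of_gradientSupCertificate (hμ : 0 < μ) (hu₀ : ContDiff ℝ 1 u₀)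
    (hdec : HasRapidSpatialDecay u₀)
    (hcl : IsClassicalNSSolutionOn (Ico 0 T) μ 0 u p) (hu0 : u 0 = u₀)
    (hE : ∃ A : ℝ≥0∞, A < ⊤ ∧ ∀ t ∈ Ico 0 T, ∫⁻ x, ‖u t x‖ₑ ^ 2 ≤ A)
    (hblow : ∀ M : ℝ, ∃ t ∈ Ico 0 T, ∃ x : EuclideanSpace ℝ (Fin 3), M < ‖fderiv ℝ (u t) x‖) :
    ¬ clayR3.Solvable μ 0 u₀ :=
  not_clayR3_solvable_of_derivSupCertificate hμ hu₀ hdec hcl hu0 hE (n := 1) fun M => by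
    obtain ⟨t, ht, x, hM⟩ := hblow M
    exact ⟨t, ht, x, by rwa [norm_iteratedFDeriv_one]⟩

/-- **A VORTICITY sup-norm blow-up certificate excludes Clay solvability** (Beale–Kato–Majda form:
`|curl u|` unbounded on `[0, T) × ℝ³`; pointwise `|curl v| ≤ κ ‖∇v‖` with `κ = ‖curlCLM‖`, tree lemma
`norm_curl_le`). [cite: FeffermanClay2006, (A) (C) with (4)–(7) p. 2] [cite: BealeKatoMajda1984, §1] -/
theorem not_clayR3_solvable_of_vorticitySupCertificate (hμ : 0 < μ) (hu₀ : ContDiff ℝ 1 u₀)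
    (hdec : HasRapidSpatialDecay u₀)
    (hcl : IsClassicalNSSolutionOn (Ico 0 T) μ 0 u p) (hu0 : u 0 = u₀)
    (hE : ∃ A : ℝ≥0∞, A < ⊤ ∧ ∀ t ∈ Ico 0 T, ∫⁻ x, ‖u t x‖ₑ ^ 2 ≤ A)
    (hblow : ∀ M : ℝ, ∃ t ∈ Ico 0 T, ∃ x : EuclideanSpace ℝ (Fin 3), M < ‖curl (u t) x‖) :
    ¬ clayR3.Solvable μ 0 u₀ := by
  refine not_clayR3_solvable_of_gradientSupCertificate hμ hu₀ hdec hcl hu0 hE fun M => ?_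
  obtain ⟨t, ht, x, hM⟩ := hblow (‖curlCLM‖ * max M 0)
  refine ⟨t, ht, x, (le_max_left M 0).trans_lt ?_⟩
  exact lt_of_mul_lt_mul_left (hM.trans_le (norm_curl_le (u t) x))
    (ContinuousLinearMap.opNorm_nonneg curlCLM)

/-- **One derivative sup-norm blow-up certificate at one viscosity `μ > 0` proves Clay (C)** (leaf
`NavierStokesBreakdownR3`, every viscosity, via `navierStokesBreakdownR3_of_not_solvable`); the datum
must be smooth, divergence free and of class (4), the solution classical with finite energy on
`[0, T)`. [cite: FeffermanClay2006, (C) p. 2] [cite: Tao2011, Cor. 11.4 + Cor. 11.1] -/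
theorem navierStokesBreakdownR3_of_derivSupCertificate (hμ : 0 < μ) (hu₀ : ContDiff ℝ ∞ u₀)
    (hdiv : NSWave0.IsDivFree u₀) (hdec : HasRapidSpatialDecay u₀)
    (hcl : IsClassicalNSSolutionOn (Ico 0 T) μ 0 u p) (hu0 : u 0 = u₀)
    (hE : ∃ A : ℝ≥0∞, A < ⊤ ∧ ∀ t ∈ Ico 0 T, ∫⁻ x, ‖u t x‖ₑ ^ 2 ≤ A) {n : ℕ}
    (hblow : ∀ M : ℝ, ∃ t ∈ Ico 0 T, ∃ x : EuclideanSpace ℝ (Fin 3),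
      M < ‖iteratedFDeriv ℝ n (u t) x‖) :
    Summit.NavierStokesRegularity.NavierStokesRegularity.NavierStokesBreakdownR3 :=
  navierStokesBreakdownR3_of_not_solvable hμ hu₀ hdiv hdec isSmoothOnHalfSpace_zero
    clayR3_force_zero
    (not_clayR3_solvable_of_derivSupCertificate hμ (hu₀.of_le (by norm_cast)) hdec hcl hu0 hE
      hblow)

/-- **One velocity sup-norm blow-up certificate at one viscosity `μ > 0` proves Clay (C).**
[cite: FeffermanClay2006, (C) p. 2] [cite: Tao2011, Cor. 11.4 + Cor. 11.1] -/
theorem navierStokesBreakdownR3_of_velocitySupCertificate (hμ : 0 < μ) (hu₀ : ContDiff ℝ ∞ u₀)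
    (hdiv : NSWave0.IsDivFree u₀) (hdec : HasRapidSpatialDecay u₀)
    (hcl : IsClassicalNSSolutionOn (Ico 0 T) μ 0 u p) (hu0 : u 0 = u₀)
    (hE : ∃ A : ℝ≥0∞, A < ⊤ ∧ ∀ t ∈ Ico 0 T, ∫⁻ x, ‖u t x‖ₑ ^ 2 ≤ A)
    (hblow : ∀ M : ℝ, ∃ t ∈ Ico 0 T, ∃ x : EuclideanSpace ℝ (Fin 3), M < ‖u t x‖) :
    Summit.NavierStokesRegularity.NavierStokesRegularity.NavierStokesBreakdownR3 :=
  navierStokesBreakdownR3_of_not_solvable hμ hu₀ hdiv hdec isSmoothOnHalfSpace_zero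
    clayR3_force_zero
    (not_clayR3_solvable_of_velocitySupCertificate hμ (hu₀.of_le (by norm_cast)) hdec hcl hu0 hE
      hblow)

/-- **One gradient sup-norm blow-up certificate at one viscosity `μ > 0` proves Clay (C).**
[cite: FeffermanClay2006, (C) p. 2] [cite: BealeKatoMajda1984, §1] -/
theorem navierStokesBreakdownR3_of_gradientSupCertificate (hμ : 0 < μ) (hu₀ : ContDiff ℝ ∞ u₀)
    (hdiv : NSWave0.IsDivFree u₀) (hdec : HasRapidSpatialDecay u₀)
    (hcl : IsClassicalNSSolutionOn (Ico 0 T) μ 0 u p) (hu0 : u 0 = u₀)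
    (hE : ∃ A : ℝ≥0∞, A < ⊤ ∧ ∀ t ∈ Ico 0 T, ∫⁻ x, ‖u t x‖ₑ ^ 2 ≤ A)
    (hblow : ∀ M : ℝ, ∃ t ∈ Ico 0 T, ∃ x : EuclideanSpace ℝ (Fin 3), M < ‖fderiv ℝ (u t) x‖) :
    Summit.NavierStokesRegularity.NavierStokesRegularity.NavierStokesBreakdownR3 :=
  navierStokesBreakdownR3_of_not_solvable hμ hu₀ hdiv hdec isSmoothOnHalfSpace_zero
    clayR3_force_zero
    (not_clayR3_solvable_of_gradientSupCertificate hμ (hu₀.of_le (by norm_cast)) hdec hcl hu0 hE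
      hblow)

/-- **One vorticity sup-norm blow-up certificate at one viscosity `μ > 0` proves Clay (C)**
(Beale–Kato–Majda form on `ℝ³`). [cite: FeffermanClay2006, (C) p. 2] [cite: BealeKatoMajda1984, §1] -/
theorem navierStokesBreakdownR3_of_vorticitySupCertificate (hμ : 0 < μ) (hu₀ : ContDiff ℝ ∞ u₀)
    (hdiv : NSWave0.IsDivFree u₀) (hdec : HasRapidSpatialDecay u₀)
    (hcl : IsClassicalNSSolutionOn (Ico 0 T) μ 0 u p) (hu0 : u 0 = u₀)
    (hE : ∃ A : ℝ≥0∞, A < ⊤ ∧ ∀ t ∈ Ico 0 T, ∫⁻ x, ‖u t x‖ₑ ^ 2 ≤ A)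
    (hblow : ∀ M : ℝ, ∃ t ∈ Ico 0 T, ∃ x : EuclideanSpace ℝ (Fin 3), M < ‖curl (u t) x‖) :
    Summit.NavierStokesRegularity.NavierStokesRegularity.NavierStokesBreakdownR3 :=
  navierStokesBreakdownR3_of_not_solvable hμ hu₀ hdiv hdec isSmoothOnHalfSpace_zero
    clayR3_force_zero
    (not_clayR3_solvable_of_vorticitySupCertificate hμ (hu₀.of_le (by norm_cast)) hdec hcl hu0 hE
      hblow)

end

end Literature.Claims.NS.ClayVariants

-- WHAT THIS IS NOT: not a claim about NS regularity or blow-up; not a claim about any author beyond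
-- the typed locator.
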